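import Mathlib
import HarnessLib
import Literature.Analysis.FluidPDE.ClassicalSolution
import Literature.Analysis.FluidPDE.SuitableWeak
import Literature.Analysis.FluidPDE.BarkerPrangeLocalizedSmoothingBounds
import Literature.Analysis.FluidPDE.BarkerPrangeConcentrationProofs
import Literature.Analysis.FluidPDE.AncientWeakL3BackwardLiouvilleAssembly
import Summits.NavierStokesRegularity.NavierStokesRegularity.Theorems.QuarterLogPincerFlatChainSliceDefs
import Summits.NavierStokesRegularity.NavierStokesRegularity.Theorems.QuarterLogPincerFlatChainSliceFrame
import Summits.NavierStokesRegularity.NavierStokesRegularity.Theorems.QuarterLogPincerFlatChainSlicePressure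
import Summits.NavierStokesRegularity.NavierStokesRegularity.Theorems.QuarterLogPincerFlatChainBoundedRegularity
import Summits.NavierStokesRegularity.NavierStokesRegularity.Theorems.QuarterLogPincerFlatChainLevelConcentrationTools

/-!
# Route `QuarterLogPincer`, crux `TypeIQuantSubcubicExp` (stmt-NavierStokesRegularity-24077), line `flat_chain` —
# B1|P `SliceWindowBound` and B2 `BoundedCylinderRegular` BY NAME (v1.14, LINE g15-1 «light_slice»)

The two registered obligations into which ns-idea-7 g15 splits β|P (`Lines/flat_chain.lean` v1.14, §12; definitions
`…FlatChainSliceDefs` part 2), closed under their registered names: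

* B1|P `stub_sliceWindowBound_of_slice : LocalEnergySlice → SliceWindowBound` (`sliceWindowBound_of_slice_holds`): P at
  `(x, t⋆ = t₁ − 2s, r = ϑ√s/2, S)`, `ϑ := √(8/S_BP(Mt))` (so `Sr² = 2s`); the light test ball `B(x, ϑ√s) = B(x, 2r)` gives
  `‖v(0)‖_{L³(B₂(0))} ≤ γ_BP` (`eLpNorm_comp_add_smul_ball`); Barker–Prange (i) `BarkerPrange2020_thm1_slab_bounds` at
  `β₀ = S/2`: `‖v‖ ≤ C` a.e. on `(S/2, S) × B(0, 1/3)`, everywhere by continuity (`sliceField_continuousOn`,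
  `norm_le_of_ae_le_of_continuousOn`); unscaled: `‖u(t, y)‖ ≤ C/r = (2C/ϑ)s^{-1/2}` for `t ∈ (t₁ − s, t₁)`, `|y − x| < ϑ√s/6 = r/3`.
  Also the unconditional `sliceWindowBound_holds` (P = `stub_localEnergySlice`, PROVED).
* B2 `stub_boundedCylinderRegular : BoundedCylinderRegular` (`boundedCylinderRegular_holds`): from the tree's
  `boundedRegularity` (`…FlatChainBoundedRegularity`: `‖u‖ ≤ K` on `Q_ρ(z)`, `Kρ ≤ κ₀(M)` ⇒ bounds at ratio `θ(M)`) by shrinking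
  the cylinder: `ρ := λϱ`, `λ := min(1, κ₀/B)`, `K := B/ϱ`, `Kρ = Bλ ≤ κ₀`; `κ := θλ`, `c_K := c⋆`.

* the §12 kernel `lightSliceRegular_of_windowBound_of_cylinder : SliceWindowBound → BoundedCylinderRegular → LightSliceRegular`
  VERBATIM (v1.14, sorry-free there), so that the whole of §12 is importable (β itself is ALSO the tree's `lightSliceRegular_holds`,
  `…FlatChainLightSlice`, by a direct proof).

HONEST FRAMING: theorems about HYPOTHETICAL Type-I classical solutions composed from PROVED tree results; they close two
registered stubs of one line; nothing here bears on the truth of ⟨24077⟩, W7 or Navier–Stokes regularity (OPEN / not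
proved).  pub-ns-dss typer (g39), `--supports stmt-NavierStokesRegularity-24077`.
-/

set_option linter.dupNamespace false

noncomputable section

open MeasureTheory Set Function Filter Topology Metric
open scoped ENNReal NNReal
open Literature.Analysis Literature.Analysis.FluidPDE

namespace Summit.NavierStokesRegularity.NavierStokesRegularity.Cruxes.TypeIQuantSubcubicExp.FlatChain

/-- **B2 (PROVED).** `BoundedCylinderRegular` — see the module docstring. -/
theorem boundedCylinderRegular_holds : BoundedCylinderRegular := by
  intro M B hM hB
  obtain ⟨θ, κ, cs, hθ, hθ1, hκ, hcs, HR⟩ := boundedRegularity M hM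
  obtain ⟨l, hldef⟩ : ∃ l : ℝ, min 1 (κ / B) = l := ⟨_, rfl⟩
  have hl0 : 0 < l := by rw [← hldef]; exact lt_min one_pos (by positivity)
  have hl1 : l ≤ 1 := by rw [← hldef]; exact min_le_left _ _
  have hlκ : l ≤ κ / B := by rw [← hldef]; exact min_le_right _ _
  have hθl1 : θ * l ≤ 1 := by nlinarith only [hθ, hθ1, hl0, hl1]
  refine ⟨θ * l, cs, mul_pos hθ hl0, hθl1, hcs, ?_⟩
  intro T τ u p hfr hτ hrate z ϱ hϱ hϱz hzT hbound t ht x hx j hj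
  have hK0 : 0 ≤ B / ϱ := by positivity
  have hϱ' : 0 < l * ϱ := by positivity
  have hl2 : l ^ 2 ≤ 1 := by nlinarith only [hl0, hl1]
  have hll : (l * ϱ) ^ 2 ≤ ϱ ^ 2 := by rw [mul_pow]; nlinarith only [hl2, sq_nonneg ϱ]
  have hϱ'z : (l * ϱ) ^ 2 ≤ z.1 := hll.trans hϱz
  have hsub : ∀ w ∈ parabolicCylinder (l * ϱ) z, ‖u w.1 w.2‖ ≤ B / ϱ := by
    intro w hw
    apply hbound
    rw [mem_parabolicCylinder] at hw ⊢
    refine ⟨⟨by linarith only [hw.1.1, hll], hw.1.2⟩, lt_of_lt_of_le hw.2 ?_⟩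
    nlinarith only [hl1, hϱ, hl0]
  have hKϱ : B / ϱ * (l * ϱ) ≤ κ := by
    have e : B / ϱ * (l * ϱ) = B * l := by field_simp
    rw [e]
    have h := mul_le_mul_of_nonneg_left hlκ hB.le
    have e' : B * (κ / B) = κ := by field_simp
    linarith only [h, e']
  have ht' : t ∈ Icc (z.1 - (θ * (l * ϱ) / 2) ^ 2) z.1 := by simpa only [mul_assoc] using ht
  have hx' : x ∈ ball z.2 (θ * (l * ϱ) / 2) := by simpa only [mul_assoc] using hx
  have h := HR T τ u p hfr hτ hrate (B / ϱ) z (l * ϱ) hK0 hϱ' hϱ'z hzT hsub hKϱ t ht' x hx' j hj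
  simpa only [mul_assoc] using h

/-- B2 under its registered skeleton name (v1.14). -/
theorem stub_boundedCylinderRegular : BoundedCylinderRegular := boundedCylinderRegular_holds

/-- **B1|P (PROVED).** `LocalEnergySlice → SliceWindowBound` — see the module docstring. -/
theorem sliceWindowBound_of_slice_holds : LocalEnergySlice → SliceWindowBound := by
  intro hP M hM
  obtain ⟨Mt, hMt, HP⟩ := hP M
  obtain ⟨γ, hγ, HBP⟩ := BarkerPrange2020_thm1_slab_bounds
  obtain ⟨S, hS, hS4, HS⟩ := HBP Mt hMt
  obtain ⟨Cb, C₁, hCb, -, HB⟩ := HS (S / 2) ⟨by linarith, by linarith⟩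
  have hS1 : S ≤ 1 := hS4.trans (by norm_num)
  obtain ⟨ϑ, hϑdef⟩ : ∃ ϑ : ℝ, Real.sqrt (8 / S) = ϑ := ⟨_, rfl⟩
  have hϑ0 : 0 < ϑ := by rw [← hϑdef]; exact Real.sqrt_pos.2 (by positivity)
  have hϑ2 : ϑ ^ 2 = 8 / S := by rw [← hϑdef]; exact Real.sq_sqrt (by positivity)
  have hϑ2' : 2 ≤ ϑ := by
    rw [← hϑdef, show (2 : ℝ) = Real.sqrt (2 ^ 2) by rw [Real.sqrt_sq (by norm_num : (0 : ℝ) ≤ 2)]]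
    refine Real.sqrt_le_sqrt ?_
    rw [le_div_iff₀ hS]; nlinarith only [hS1, hS]
  refine ⟨γ, ϑ, 2 * Cb / ϑ, hγ, hϑ2', by positivity, ?_⟩
  intro T τ u p hfr hτ hrate t₁ s x hs h2s hϑsT ht₁T hcubeL t ht y hy
  -- ## scales: `q = √s`, `t⋆ = t₁ − 2s`, `r = ϑq/2`
  obtain ⟨q, hqdef⟩ : ∃ q : ℝ, Real.sqrt s = q := ⟨_, rfl⟩
  have hq0 : 0 < q := by rw [← hqdef]; exact Real.sqrt_pos.2 hs
  have hq2 : q ^ 2 = s := by rw [← hqdef]; exact Real.sq_sqrt hs.le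
  obtain ⟨tstar, htsdef⟩ : ∃ t' : ℝ, t₁ - 2 * s = t' := ⟨_, rfl⟩
  have hts0 : 0 ≤ tstar := by rw [← htsdef]; linarith only [h2s]
  obtain ⟨r, hrdef⟩ : ∃ r' : ℝ, ϑ * q / 2 = r' := ⟨_, rfl⟩
  have hr0 : 0 < r := by rw [← hrdef]; positivity
  have h2r : ϑ * q = 2 * r := by rw [← hrdef]; ring
  have hr2 : r ^ 2 = (ϑ / 2) ^ 2 * s := by rw [← hrdef, ← hq2]; ring
  have hSr : S * r ^ 2 = 2 * s := by
    rw [hr2, div_pow, hϑ2]; field_simp; ring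
  have hwin : tstar + S * r ^ 2 ≤ T := by rw [hSr, ← htsdef]; linarith only [ht₁T]
  have hr2T : r ^ 2 ≤ T := by rw [hr2]; exact hϑsT
  rw [hqdef, htsdef, h2r] at hcubeL
  rw [hqdef] at hy
  -- ## P: the rescaled slice about `(t⋆, x)` is a local energy solution with `E²` datum and uloc bound `Mt`
  obtain ⟨π, hles, hE2, huloc⟩ := HP T τ u p hfr hτ hrate x tstar r S hr0 hS hS1 hts0 hr2T hwin
  -- ## `‖u(t⋆)‖_{L³(B(x,2r))} ≤ γ`, transported to the rescaled datum
  have hcube' : ∫⁻ z in ball x (2 * r), ‖u tstar z‖ₑ ^ 3 ≤ ENNReal.ofReal (γ ^ 3) := by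
    have e : ∫⁻ z in ball x (2 * r), ‖u tstar z‖ₑ ^ (3 : ℝ) = ∫⁻ z in ball x (2 * r), ‖u tstar z‖ₑ ^ 3 :=
      lintegral_congr fun z => by rw [show (3 : ℝ) = ((3 : ℕ) : ℝ) by norm_num, ENNReal.rpow_natCast]
    rw [← e]; exact hcubeL
  have hL3u : eLpNorm (u tstar) 3 (volume.restrict (ball x (2 * r))) ≤ ENNReal.ofReal γ := by
    rw [eLpNorm_eq_lintegral_rpow_enorm_toReal three_ne_zero ENNReal.ofNat_ne_top, ENNReal.toReal_ofNat]
    have e3 : ∫⁻ z in ball x (2 * r), ‖u tstar z‖ₑ ^ (3 : ℝ) = ∫⁻ z in ball x (2 * r), ‖u tstar z‖ₑ ^ 3 :=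
      lintegral_congr fun z => by rw [show (3 : ℝ) = ((3 : ℕ) : ℝ) by norm_num, ENNReal.rpow_natCast]
    rw [e3]
    calc (∫⁻ z in ball x (2 * r), ‖u tstar z‖ₑ ^ 3) ^ (1 / (3 : ℝ)) ≤ (ENNReal.ofReal (γ ^ 3)) ^ (1 / (3 : ℝ)) :=
          ENNReal.rpow_le_rpow hcube' (by norm_num)
      _ = ENNReal.ofReal ((γ ^ 3) ^ (1 / (3 : ℝ))) := ENNReal.ofReal_rpow_of_nonneg (by positivity) (by norm_num)
      _ = ENNReal.ofReal γ := by
          rw [← Real.rpow_natCast γ 3, ← Real.rpow_mul hγ.le]; norm_num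
  have hv0 : sliceField u x tstar r 0 = fun z => r • u tstar (x + r • z) := by
    funext z; rw [sliceField_apply, mul_zero, add_zero]
  have hsmul : ∀ (q' : ℝ≥0∞) (μ : Measure (EuclideanSpace ℝ (Fin 3))),
      eLpNorm (fun z => r • u tstar (x + r • z)) q' μ = ‖r‖ₑ * eLpNorm (fun z => u tstar (x + r • z)) q' μ :=
    fun q' μ => by
      rw [show (fun z => r • u tstar (x + r • z)) = r • fun z => u tstar (x + r • z) from rfl, eLpNorm_const_smul]
  have hlr : ‖r‖ₑ = ENNReal.ofReal r := Real.enorm_eq_ofReal hr0.le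
  have hL3' : eLpNorm (sliceField u x tstar r 0) 3 (volume.restrict (ball (0 : EuclideanSpace ℝ (Fin 3)) 2)) ≤
      ENNReal.ofReal γ := by
    rw [hv0]
    calc eLpNorm (fun z => r • u tstar (x + r • z)) 3 (volume.restrict (ball (0 : EuclideanSpace ℝ (Fin 3)) 2))
        = ‖r‖ₑ * (ENNReal.ofReal ((r ^ 3)⁻¹) ^ (1 / (3 : ℝ≥0∞)).toReal *
            eLpNorm (u tstar) 3 (volume.restrict (ball (x + r • (0 : EuclideanSpace ℝ (Fin 3))) (r * 2)))) := by
          rw [hsmul, eLpNorm_comp_add_smul_ball (u tstar) x 0 hr0 2 (by norm_num)]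
      _ ≤ ‖r‖ₑ * (ENNReal.ofReal r⁻¹ * ENNReal.ofReal γ) := by
          rw [ofReal_inv_cube_rpow_third hr0, smul_zero, add_zero, mul_comm r 2]
          gcongr
      _ = ENNReal.ofReal γ := by
          rw [hlr, ← ENNReal.ofReal_mul (by positivity), ← ENNReal.ofReal_mul (by positivity)]
          congr 1
          field_simp
  -- ## Barker–Prange (i): `‖v‖ ≤ Cb` a.e. on `(S/2,S) × B(0,1/3)`, hence everywhere there
  obtain ⟨hae, -, -⟩ := HB _ _ π hles hE2 huloc hL3'
  have hcontv := sliceField_continuousOn hfr.1 x hr0 hS hts0 hwin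
  set U : Set (ℝ × EuclideanSpace ℝ (Fin 3)) := Ioo (S / 2) S ×ˢ ball (0 : EuclideanSpace ℝ (Fin 3)) (1 / 3) with hU
  have hUsub : U ⊆ Icc 0 S ×ˢ (univ : Set (EuclideanSpace ℝ (Fin 3))) :=
    prod_mono (fun s' hs' => ⟨by linarith [hs'.1], hs'.2.le⟩) (subset_univ _)
  have hae' : ∀ᵐ z ∂(volume.restrict U), ‖Function.uncurry (sliceField u x tstar r) z‖ ≤ Cb :=
    hae.mono fun w hw => hw
  have hall := norm_le_of_ae_le_of_continuousOn (isOpen_Ioo.prod isOpen_ball) (hcontv.mono hUsub) hae'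
  -- ## the point `(t, y)` rescaled: `σ = (t − t⋆)/r² ∈ (S/2, S)`, `η = (y − x)/r ∈ B(0, 1/3)`
  have hσ1 : S / 2 < (t - tstar) / r ^ 2 := by
    rw [lt_div_iff₀ (pow_pos hr0 2)]
    have e : S / 2 * r ^ 2 = s := by linarith only [hSr]
    rw [e]
    linarith only [ht.1, htsdef]
  have hσ2 : (t - tstar) / r ^ 2 < S := by
    rw [div_lt_iff₀ (pow_pos hr0 2), hSr]
    linarith only [ht.2, htsdef]
  have hη : r⁻¹ • (y - x) ∈ ball (0 : EuclideanSpace ℝ (Fin 3)) (1 / 3) := by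
    rw [mem_ball_zero_iff, norm_smul, Real.norm_of_nonneg (inv_nonneg.2 hr0.le)]
    rw [mem_ball, dist_eq_norm] at hy
    have e : r⁻¹ * (ϑ * q / 6) = 1 / 3 := by
      rw [← hrdef, inv_mul_eq_div, div_eq_div_iff (by positivity) (by norm_num)]; ring
    calc r⁻¹ * ‖y - x‖ < r⁻¹ * (ϑ * q / 6) := mul_lt_mul_of_pos_left hy (inv_pos.2 hr0)
      _ = 1 / 3 := e
  have hwU : ((t - tstar) / r ^ 2, r⁻¹ • (y - x)) ∈ U := ⟨⟨hσ1, hσ2⟩, hη⟩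
  have hb := hall _ hwU
  have e1 : tstar + r ^ 2 * ((t - tstar) / r ^ 2) = t := by
    rw [mul_div_cancel₀ _ (pow_ne_zero 2 hr0.ne')]; ring
  have e2 : x + r • (r⁻¹ • (y - x)) = y := by
    rw [smul_smul, mul_inv_cancel₀ hr0.ne', one_smul, add_sub_cancel]
  rw [Function.uncurry_apply_pair, sliceField_apply, e1, e2, norm_smul, Real.norm_of_nonneg hr0.le] at hb
  -- ## `‖u(t,y)‖ ≤ Cb/r = (2Cb/ϑ) s^{-1/2}`
  have hsinv : s ^ (-(1 / 2 : ℝ)) = q⁻¹ := by rw [Real.rpow_neg hs.le, ← Real.sqrt_eq_rpow, hqdef]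
  have e : 2 * Cb / ϑ * q⁻¹ = Cb / r := by
    rw [← hrdef, ← div_eq_mul_inv, div_div, div_eq_div_iff (by positivity) (by positivity)]; ring
  rw [hsinv, e, le_div_iff₀ hr0, mul_comm]
  exact hb

/-- B1|P under its registered skeleton name (v1.14). -/
theorem stub_sliceWindowBound_of_slice : LocalEnergySlice → SliceWindowBound := sliceWindowBound_of_slice_holds

/-- **B1 (PROVED, unconditional):** `SliceWindowBound`, from B1|P and P `stub_localEnergySlice`. -/
theorem sliceWindowBound_holds : SliceWindowBound := sliceWindowBound_of_slice_holds stub_localEnergySlice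

section KernelG15

open Summit.NavierStokesRegularity.NavierStokesRegularity.Cruxes.TypeIQuantSubcubicExp.BeadCensus (levelScale)

/-! ### The §12 kernel of LINE g15-1 (ns-idea-7 g15, v1.14), VERBATIM: B1 → B2 → β -/

/-- **KERNEL of LINE g15-1 (sorry-free): B1 → B2 → β.**  Constants: `R := 2ρ√s` (window points are light-block points since `ρ ≥ 4M > 0`,
`Λ·R ≤ e^{a}√s` from `4Λρ ≤ e^{a}`); `a₂ := (ϑ/2)² + 1` (so `2s ≤ s·3 ≤ t₁` and `(ϑ/2)²s ≤ T`); B2 at vertex `z = (t, x)` for EACH window time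
`t ∈ [t₁ − s/32, t₁]` with `ϱ := √s/3` (`Q_ϱ(z) ⊂ (t₁ − s, t₁) × B(x, ϑ√s/6)` as `ϑ ≥ 2`), `B := C_b/3`; read off at the vertex:
`c_K(κ√s/3)^{-(j+1)} ≤ c_K(3/κ)³ s^{-(j+1)/2}`, `Cg := max 1 (c_K(3/κ)³)`. -/
theorem lightSliceRegular_of_windowBound_of_cylinder (h1 : SliceWindowBound) (h2 : BoundedCylinderRegular) :
    LightSliceRegular := by
  intro M hM
  obtain ⟨γ, ϑ, Cb, hγ, hϑ2, hCb, H1⟩ := h1 M hM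
  obtain ⟨κ, cK, hκ, hκ1, hcK, H2⟩ := h2 M (Cb / 3) hM (by positivity)
  have hM0 : 0 < M := lt_of_lt_of_le one_pos hM
  have hϑ0 : 0 < ϑ := lt_of_lt_of_le two_pos hϑ2
  set Cg : ℝ := max 1 (cK * (3 / κ) ^ 3) with hCg
  refine ⟨Cg, γ, ϑ, (ϑ / 2) ^ 2 + 1, le_max_left _ _, hγ, by linarith, by positivity, ?_⟩
  intro Λ a hΛ ha T τ t₁ x₀ u p k ρ hfr hτ hrate ht₁ hρM hρϑ hρΛ hlight
  have ht₁0 : 0 < t₁ := ht₁.1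
  have ht₁T : t₁ ≤ T := ht₁.2
  have hρ0 : 0 < ρ := by linarith
  have hΛ0 : 0 < Λ := lt_of_lt_of_le one_pos hΛ
  have ha1 : 1 ≤ a := le_trans (by nlinarith [sq_nonneg (ϑ / 2)]) ha
  have ha0 : 0 ≤ a := le_trans zero_le_one ha1
  -- ## the scale `s = s_{k+1}` and its size
  set s : ℝ := levelScale a t₁ (k + 1) with hs
  have hsE : s = t₁ * Real.exp (-2 * a * ((k + 1 : ℕ) : ℝ)) := by rw [hs, levelScale]
  have hs0 : 0 < s := by rw [hsE]; positivity
  have hsqrt : 0 < Real.sqrt s := Real.sqrt_pos.2 hs0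
  have hexp2a : 2 * a + 1 ≤ Real.exp (2 * a) := Real.add_one_le_exp (2 * a)
  have hk1 : (1 : ℝ) ≤ ((k + 1 : ℕ) : ℝ) := by exact_mod_cast Nat.le_add_left 1 k
  have hEa : Real.exp (-2 * a * ((k + 1 : ℕ) : ℝ)) ≤ Real.exp (-(2 * a)) := by
    refine Real.exp_le_exp.2 ?_
    have h := mul_le_mul_of_nonneg_left hk1 (by linarith only [ha0] : (0 : ℝ) ≤ 2 * a)
    linarith only [h]
  have he3 : Real.exp (-(2 * a)) ≤ 1 / 3 := by
    refine q4_exp_neg_le ?_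
    linarith only [hexp2a, ha1]
  have heϑ : Real.exp (-(2 * a)) ≤ 1 / ((ϑ / 2) ^ 2 + 1) := by
    refine q4_exp_neg_le ?_
    rw [div_mul_eq_mul_div, one_mul, le_div_iff₀ (by positivity)]
    linarith only [hexp2a, ha, ha1]
  have hs3 : s ≤ t₁ / 3 := by
    calc s = t₁ * Real.exp (-2 * a * ((k + 1 : ℕ) : ℝ)) := hsE
      _ ≤ t₁ * Real.exp (-(2 * a)) := mul_le_mul_of_nonneg_left hEa ht₁0.le
      _ ≤ t₁ * (1 / 3) := mul_le_mul_of_nonneg_left he3 ht₁0.le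
      _ = t₁ / 3 := by ring
  have h2s : 2 * s ≤ t₁ := by linarith only [hs3, hs0]
  have hsϑ : (ϑ / 2) ^ 2 * s ≤ T := by
    have hfrac : (ϑ / 2) ^ 2 / ((ϑ / 2) ^ 2 + 1) ≤ 1 := by
      rw [div_le_one (by positivity)]; linarith
    calc (ϑ / 2) ^ 2 * s ≤ (ϑ / 2) ^ 2 * (t₁ * Real.exp (-(2 * a))) := by
          rw [hsE]; exact mul_le_mul_of_nonneg_left (mul_le_mul_of_nonneg_left hEa ht₁0.le) (by positivity)
      _ ≤ (ϑ / 2) ^ 2 * (t₁ * (1 / ((ϑ / 2) ^ 2 + 1))) := by gcongr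
      _ = t₁ * ((ϑ / 2) ^ 2 / ((ϑ / 2) ^ 2 + 1)) := by ring
      _ ≤ t₁ * 1 := mul_le_mul_of_nonneg_left hfrac ht₁0.le
      _ ≤ T := by rw [mul_one]; exact ht₁T
  -- ## the witness radius `R = 2ρ√s`
  show ∃ R : ℝ, 4 * M * Real.sqrt s ≤ R ∧ Λ * R ≤ Real.exp a * Real.sqrt s ∧
    ∀ t ∈ Icc (t₁ - s / 32) t₁, ∀ x : EuclideanSpace ℝ (Fin 3), R < ‖x - x₀‖ → ‖x - x₀‖ < Λ * R →
      ∀ j : ℕ, j ≤ 2 → ‖iteratedFDeriv ℝ j (u t) x‖ ≤ Cg * s ^ (-(((j : ℝ) + 1) / 2))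
  refine ⟨2 * ρ * Real.sqrt s, ?_, ?_, ?_⟩
  · have h : 4 * M ≤ 2 * ρ := by linarith
    exact mul_le_mul_of_nonneg_right h hsqrt.le
  · calc Λ * (2 * ρ * Real.sqrt s) = 2 * Λ * ρ * Real.sqrt s := by ring
      _ ≤ 4 * Λ * ρ * Real.sqrt s := by
          have h : 2 * Λ * ρ ≤ 4 * Λ * ρ := by nlinarith [mul_pos hΛ0 hρ0]
          exact mul_le_mul_of_nonneg_right h hsqrt.le
      _ ≤ Real.exp a * Real.sqrt s := mul_le_mul_of_nonneg_right hρΛ hsqrt.le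
  intro t ht x hxR hxΛ j hj
  -- ## `x` is a light-block point ⇒ small cube mass of the slice `u(t₁ − 2s)` on `B(x, ϑ√s)`
  have hρs0 : 0 ≤ ρ * Real.sqrt s := by positivity
  have hx1 : ρ * Real.sqrt s ≤ ‖x - x₀‖ := by linarith only [hxR, hρs0]
  have hx2 : ‖x - x₀‖ ≤ 4 * Λ * ρ * Real.sqrt s := by
    have h : Λ * (2 * ρ * Real.sqrt s) ≤ 4 * Λ * ρ * Real.sqrt s := by
      have h' : 2 * Λ * ρ ≤ 4 * Λ * ρ := by nlinarith [mul_pos hΛ0 hρ0]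
      calc Λ * (2 * ρ * Real.sqrt s) = 2 * Λ * ρ * Real.sqrt s := by ring
        _ ≤ 4 * Λ * ρ * Real.sqrt s := mul_le_mul_of_nonneg_right h' hsqrt.le
    linarith only [hxΛ, h]
  have hL3 : ∫⁻ y in ball x (ϑ * Real.sqrt s), ‖u (t₁ - 2 * s) y‖ₑ ^ (3 : ℝ) ≤ ENNReal.ofReal (γ ^ 3) :=
    hlight x hx1 hx2
  -- ## B1: the window bound on `(t₁ − s, t₁) × B(x, ϑ√s/6)`
  have HB := H1 T τ u p hfr hτ hrate t₁ s x hs0 h2s hsϑ ht₁T hL3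
  -- ## B2 at the vertex `(t, x)`, radius `ϱ = √s/3`
  obtain ⟨ϱ, hϱdef⟩ : ∃ ϱ : ℝ, ϱ = Real.sqrt s / 3 := ⟨_, rfl⟩
  have hϱ0 : 0 < ϱ := by rw [hϱdef]; positivity
  have hϱ2 : ϱ ^ 2 = s / 9 := by rw [hϱdef, div_pow, Real.sq_sqrt hs0.le]; norm_num
  have htt₁ : t ≤ t₁ := ht.2
  have ht32 : t₁ - s / 32 ≤ t := ht.1
  have hϱt : ϱ ^ 2 ≤ t := by rw [hϱ2]; linarith only [ht32, hs3, hs0]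
  have htT : t ≤ T := htt₁.trans ht₁T
  have hbd : ∀ w ∈ parabolicCylinder ϱ ((t, x) : ℝ × EuclideanSpace ℝ (Fin 3)), ‖u w.1 w.2‖ ≤ Cb / 3 / ϱ := by
    intro w hw
    rw [mem_parabolicCylinder] at hw
    obtain ⟨⟨hw1a, hw1b⟩, hw2⟩ := hw
    dsimp only at hw1a hw1b hw2
    have hw1 : w.1 ∈ Ioo (t₁ - s) t₁ := ⟨by rw [hϱ2] at hw1a; linarith only [hw1a, ht32, hs0], by linarith only [hw1b, htt₁]⟩
    have hw2' : w.2 ∈ ball x (ϑ * Real.sqrt s / 6) := by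
      rw [mem_ball]
      have h : ϱ ≤ ϑ * Real.sqrt s / 6 := by
        rw [hϱdef]
        have h' := mul_le_mul_of_nonneg_right hϑ2 hsqrt.le
        linarith only [h']
      exact lt_of_lt_of_le hw2 h
    have h := HB w.1 hw1 w.2 hw2'
    have e : Cb * s ^ (-(1 / 2 : ℝ)) = Cb / 3 / ϱ := by
      rw [hϱdef, Real.rpow_neg hs0.le, ← Real.sqrt_eq_rpow]
      field_simp [hsqrt.ne']
    rw [← e]
    exact h
  have hreg := H2 T τ u p hfr hτ hrate (t, x) ϱ hϱ0 hϱt htT hbd t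
    (show t ∈ Icc (t - (κ * ϱ / 2) ^ 2) t from ⟨by nlinarith [sq_nonneg (κ * ϱ / 2)], le_rfl⟩) x
    (mem_ball_self (by positivity : (0 : ℝ) < κ * ϱ / 2)) j hj
  -- ## read-off: `c_K (κ√s/3)^{-(j+1)} ≤ Cg s^{-(j+1)/2}`
  have hj3 : (j : ℝ) + 1 ≤ 3 := by
    have h : (j : ℝ) ≤ 2 := by exact_mod_cast hj
    linarith only [h]
  have hκ3 : 0 < κ / 3 := by positivity
  have hκ31 : κ / 3 ≤ 1 := by linarith only [hκ1]
  have hcK0 : 0 ≤ cK := le_trans zero_le_one hcK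
  have e1 : (κ * ϱ) ^ (-((j : ℝ) + 1)) = (κ / 3) ^ (-((j : ℝ) + 1)) * s ^ (-(((j : ℝ) + 1) / 2)) := by
    have hkr : κ * ϱ = (κ / 3) * Real.sqrt s := by rw [hϱdef]; ring
    rw [hkr, Real.mul_rpow hκ3.le (Real.sqrt_nonneg _), Real.sqrt_eq_rpow, ← Real.rpow_mul hs0.le,
      show (1 / 2 : ℝ) * -((j : ℝ) + 1) = -(((j : ℝ) + 1) / 2) by ring]
  have e2 : (κ / 3) ^ (-((j : ℝ) + 1)) ≤ (3 / κ) ^ 3 := by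
    calc (κ / 3) ^ (-((j : ℝ) + 1)) ≤ (κ / 3) ^ (-(3 : ℝ)) :=
          Real.rpow_le_rpow_of_exponent_ge hκ3 hκ31 (by linarith only [hj3])
      _ = (3 / κ) ^ 3 := by
          rw [Real.rpow_neg hκ3.le, ← Real.inv_rpow hκ3.le, inv_div]
          exact_mod_cast Real.rpow_natCast (3 / κ) 3
  have hspos : 0 < s ^ (-(((j : ℝ) + 1) / 2)) := Real.rpow_pos_of_pos hs0 _
  calc ‖iteratedFDeriv ℝ j (u t) x‖ ≤ cK * (κ * ϱ) ^ (-((j : ℝ) + 1)) := hreg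
    _ = cK * (κ / 3) ^ (-((j : ℝ) + 1)) * s ^ (-(((j : ℝ) + 1) / 2)) := by rw [e1, mul_assoc]
    _ ≤ cK * (3 / κ) ^ 3 * s ^ (-(((j : ℝ) + 1) / 2)) :=
        mul_le_mul_of_nonneg_right (mul_le_mul_of_nonneg_left e2 hcK0) hspos.le
    _ ≤ Cg * s ^ (-(((j : ℝ) + 1) / 2)) := mul_le_mul_of_nonneg_right (le_max_right _ _) hspos.le

end KernelG15

end Summit.NavierStokesRegularity.NavierStokesRegularity.Cruxes.TypeIQuantSubcubicExp.FlatChain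

end
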